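import Mathlib
import HarnessLib
import Summits.ValiantsHypothesis.ValiantsHypothesis.Theses.MonotoneRestoration
import Literature.Computability.AlgebraicComplexity.ArithCircuit
import Literature.Computability.AlgebraicComplexity.ArithCircuitProofs
import Literature.Computability.AlgebraicComplexity.MonotoneStructure
import Literature.Computability.AlgebraicComplexity.PermanentIrreducible
import Literature.ModelTheory.FiniteModelTheory.CkEquiv
import Summits.ValiantsHypothesis.ValiantsHypothesis.Theorems.MonotoneRestorationMonotoneRestorationQPCosetCount
import Summits.ValiantsHypothesis.ValiantsHypothesis.Theorems.MonotoneRestorationMonotoneRestorationQPSymmetricLB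
import Summits.ValiantsHypothesis.ValiantsHypothesis.Theorems.MonotoneRestorationMonotoneRestorationQPSupportSymmetrisation
import Summits.ValiantsHypothesis.ValiantsHypothesis.Theorems.MonotoneRestorationMonotoneRestorationQPSparseRegime
import Summits.ValiantsHypothesis.ValiantsHypothesis.Theorems.MonotoneRestorationMonotoneRestorationQPBeta
import Literature.Computability.AlgebraicComplexity.SymmetricArithCircuit
import Literature.Computability.AlgebraicComplexity.DawarWilsenach2025Proofs
import Literature.GroupTheory.PermutationGroups.SmallIndexSubgroups
import Summits.ValiantsHypothesis.ValiantsHypothesis.Theorems.MonotoneRestorationQP.Negative.LoadBearing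
import Summits.ValiantsHypothesis.ValiantsHypothesis.Theorems.MonotoneRestorationMonotoneRestorationQPPermSupportCount

/-! TTRL-lite variant V19981 of stmt-ValiantsHypothesis-15886 -/

-- `Summit.ValiantsHypothesis.ValiantsHypothesis.…` is the tree's mandated single-conjunct layout
-- (Sub = Summit), so the duplicated namespace component is intended.
set_option linter.dupNamespace false

namespace Summit.ValiantsHypothesis.ValiantsHypothesis.Theorems

open Summit.ValiantsHypothesis.ValiantsHypothesis.Theses.MonotoneRestoration
open Literature.Computability.AlgebraicComplexity

/-- The `+` case of the spine induction as one step: over `ℝ≥0` (no cancellation), a spine state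
`(m, e)` at an addition gate `g` is a spine state, with the same context `e`, at some child `h`
carrying the monomial `m`. TTRL-lite variant V19981 of stmt-ValiantsHypothesis-15886. -/
theorem symmetricMonotone_var19981 :
    ∀ (n : ℕ) (G : Type) (C : LabelledArithCircuit NNReal (Fin n × Fin n) Unit G) (g : G)
      (m e : Fin n × Fin n →₀ ℕ), C.label g = CircuitLabel.add → m ∈ (C.eval g).support →
      (∀ m' ∈ (C.eval g).support, m' + e ∈ (C.eval (C.output ())).support) →
      ∃ h ∈ C.children g, m ∈ (C.eval h).support ∧
        ∀ m' ∈ (C.eval h).support, m' + e ∈ (C.eval (C.output ())).support := by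
  intro n G C g m e hadd hm hctx
  have hsum : C.eval g = ∑ h ∈ C.children g, C.eval h := C.eval_of_label_add hadd
  -- `m` lies in the support of some summand
  have hm' : m ∈ (∑ h ∈ C.children g, C.eval h).support := hsum ▸ hm
  obtain ⟨h, hh, hmh⟩ := Finset.mem_biUnion.mp (MvPolynomial.support_sum hm')
  refine ⟨h, hh, hmh, fun m' hm'h => hctx m' ?_⟩
  -- no cancellation over `ℝ≥0`: the support of a child is contained in the support of the sum
  rw [MvPolynomial.mem_support_iff] at hm'h ⊢
  rw [hsum, MvPolynomial.coeff_sum]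
  intro hzero
  apply hm'h
  have hle : MvPolynomial.coeff m' (C.eval h) ≤
      ∑ x ∈ C.children g, MvPolynomial.coeff m' (C.eval x) :=
    Finset.single_le_sum (f := fun x => MvPolynomial.coeff m' (C.eval x))
      (fun x _ => (MvPolynomial.coeff m' (C.eval x)).2) hh
  rw [hzero] at hle
  exact nonpos_iff_eq_zero.mp hle

end Summit.ValiantsHypothesis.ValiantsHypothesis.Theorems
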